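import Literature.NumberTheory.EllipticCurves.KrizLi2019.SexticTwistBSDThree
import HarnessLib

/-!
# Kriz–Li 2019, Corollary 10.7 (with Theorem 10.6): the analytic ranks over `ℚ` of the sextic twist `E_d : y² = x³ − 432d` and of its quadratic twist `E_d^{(d_K)}`

HONEST FRAMING (cell `b2b-bsdres`, run/shared/lean/b2b/bsd-rank1-residual/; page 1 everywhere):
prove what is provable now; shrink each hard class to its core with data; no claim beyond stated
classes. The cell deletes the COMBINATION-SHAPED residual classes of the BSD formula in analytic
rank `≤ 1` from PUBLISHED theorems only and TYPES the construction-shaped ones; this is not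
"finishing BSD". This file vendors ONE published statement as a named fact (`def … : Prop`,
nothing asserted; D-0014), in the vocabulary of the sibling fact
`KrizLi2019.thm1010_bsdThree_overK_sexticTwist` (`SexticTwistBSDThree.lean`: the model
`y² = x³ − 432d` up to `VariableChange ℚ`, `IsImaginaryQuadratic`, `SatisfiesHeegnerHypothesis`,
`ThreeClassNumberTrivial`, Kriz–Li's hypotheses (1)–(3) word for word) and of `AnalyticRank.lean`
(`WeierstrassCurve.analyticRank` = `r_an(E/ℚ)`) and `QuadraticTwist.lean` (`quadraticTwist`).

Why it is vendored (harvest seat 1, gen 6): in the seven kernel records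
`Rank1Residual.X12SexticTwist.bsdp_three_cremona<N>_closed` (X12 ∩ {p = 3, j = 0}, the Kriz–Li
sextic-twist pairs 225a, 1323m, 1728a, 3888t, 7803b, 11907s, 15129a) the input
`hr : r_an(…1) = 1` was carried as a census datum; it is in fact case (2) of THIS corollary for
`d = 5, −7, 8, 12, 17, 21, 41` (all with `d > 0, d ≡ 3, 5, 8 (mod 9)` or `d < 0, d ≡ 2 (mod 9)`),
read on the `ℚ`-isogenous curve `…1 ~ …2 ≅ E_d` (Knapp 1993, Thm. 11.67, tree theorem
`analyticRank_eq_of_isIsogenous'`).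

## Citation header (read by this seat from the sources named)

* Authors: Daniel Kriz, Chao Li.
* Title: *Goldfeld's conjecture and congruences between Heegner points*.
* Venue: Forum of Mathematics, Sigma **7** (2019), e15, 80 pp., doi:10.1017/fms.2019.9 (open
  access; bib key `KrizLi2019`; store `paper:doi-10-1017-fms-2019-9`, §10.2 "Weak Goldfeld
  conjecture for `{E_d}`", text chunk p0028: proof of Theorem 10.6, "Corollary 10.7" used in the
  proof of Theorem 10.8, Remark 10.9). REFEREED / PUBLISHED. Journal Theorem 10.6 / Corollary 10.7 /
  Lemmas 10.4–10.5 = `\label{thm:sextic}` (ll. 1407–1421) / `\label{mod9corollary}` (ll. 1427–1438)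
  / `\label{lem:rootnumberEd}`, `\label{lem:rootnumberEd2}` (ll. 1326–1400) of the authors' LaTeX
  source `Eisenstein.tex` of arXiv:1609.06687v3 (held: HOME/b2b-bsdres-harvest-2/src/Eisenstein.tex),
  from which the statements below are copied.
* Verbatim (TeX ll. 1407–1421, Theorem 10.6 = `thm:sextic`):

> **Theorem 10.6.** Let `K = ℚ(√d_K)` be an imaginary quadratic field satisfying the Heegner
> hypothesis with respect to `3d`. Let `P_d ∈ E_d(K)` be the associated Heegner point. Assume that:
> (1) `d` is a fundamental discriminant.
> (2) `d ≡ 2 (mod 3)` or `d ≡ 3 (mod 9)`.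
> (3) If `d > 0`, then `h₃(−3d) = h₃(d_K d) = 1`. If `d < 0`, then `h₃(d) = h₃(−3 d_K d) = 1`.
> Then `log_{ω_{E_d}} P_d ≢ 0 (mod 3)`. In particular, `P_d` is of infinite order and `E_d/K` has
> both analytic and algebraic rank one.

* Verbatim (TeX ll. 1427–1438, Corollary 10.7 = `mod9corollary`):

> **Corollary 10.7.** Assume we are in the situation of Theorem 10.6.
> (1) If `d > 0` and `d ≡ 2 (mod 9)`, or `d < 0` and `d ≡ 3, 5, 8 (mod 9)`, then
>     `r_an(E_d/ℚ) = 0`, `r_an(E_d^{(d_K)}/ℚ) = 1`.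
> (2) If `d < 0` and `d ≡ 2 (mod 9)`, or `d > 0` and `d ≡ 3, 5, 8 (mod 9)`, then
>     `r_an(E_d/ℚ) = 1`, `r_an(E_d^{(d_K)}/ℚ) = 0`.
> *Proof.* It follows immediately from Theorem 10.6 using the root number calculation in Lemmas
> 10.4 and 10.5.

  (Lemma 10.4: `d` fundamental, `d ≡ 0 (mod 3)` ⇒ `w(E_d) = −sign(d)` if `d ≡ 3 (mod 9)`,
  `sign(d)` if `d ≡ 6 (mod 9)`; Lemma 10.5: `d` fundamental, `d ≡ 2 (mod 3)` ⇒ `w(E_d) = sign(d)` if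
  `d ≡ 2 (mod 9)`, `−sign(d)` if `d ≡ 5, 8 (mod 9)`; both from the local root number formulae of
  [Liverance1995, §9]. With `r_an(E_d/K) = r_an(E_d/ℚ) + r_an(E_d^{(d_K)}/ℚ) = 1` (Theorem 10.6) the
  factor with root number `−1` carries the simple zero.)

## Hypotheses, enumerated (word for word → tree vocabulary; items 1–5 literally as in `SexticTwistBSDThree.lean`)

1. `E_d : y² = x³ − 432d` (journal Def. 1.19 ff.: "the `d`th sextic twist") — `W : WeierstrassCurve ℚ`,
   elliptic, `ℚ`-isomorphic to the displayed model: `∃ C : VariableChange ℚ, C • W = ⟨0, 0, 0, 0, −432 d⟩`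
   (`r_an` is a `ℚ`-isomorphism invariant: tree theorem `analyticRank_variableChange_holds`). NO
   global-minimality and NO Manin-constant hypothesis: Theorem 10.6 / Corollary 10.7 carry none
   (hypothesis (4) "the Manin constant of `E_d` is coprime to `3`" belongs to Theorem 10.10 only).
2. "the situation of Theorem 10.6": "`K = ℚ(√d_K)` an imaginary quadratic field satisfying the
   Heegner hypothesis with respect to `3d`" — `IsImaginaryQuadratic K`,
   `SatisfiesHeegnerHypothesis (3 * d.natAbs) K`; "`P_d ∈ E_d(K)` the associated Heegner point" is a
   designation, not an assumption, and does not occur in the corollary's conclusion — no binder.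
3. (1) "`d` is a fundamental discriminant" — as in the sibling file (`d ≡ 1 (mod 4)` squarefree
   `≠ 1`, or `d = 4m`, `m ≡ 2, 3 (mod 4)` squarefree).
4. (2) "`d ≡ 2 (mod 3)` or `d ≡ 3 (mod 9)`" — `d % 3 = 2 ∨ d % 9 = 3` (`Int.emod`, non-negative
   remainder; the same set as Theorem 10.10's "`d ≡ 2, 3, 5, 8 (mod 9)`").
5. (3) the `3`-class-number conditions — `ThreeClassNumberTrivial` exactly as in the sibling fact.
6. Conclusion: "`r_an(E_d/ℚ)`" — `W.analyticRank`; "`r_an(E_d^{(d_K)}/ℚ)`" — the analytic rank of the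
   tree's quadratic-twist model `W.quadraticTwist d_K` (`QuadraticTwist.lean`; any other `ℚ`-model of
   the twist has the same `r_an` by `analyticRank_variableChange_holds`); the case conditions on
   `sign(d)` and `d mod 9` verbatim.

No `_holds` is to be expected (Theorem 10.6 is the mod-`3` non-vanishing of the `3`-adic logarithm
of a Heegner point at an Eisenstein prime — Kriz–Li's main congruence, Thm. 7.1; none of it is in
Mathlib). D-0026: exactly ONE new named fact, with a consumer (harvest seat 1 gen 6: the records
`Rank1Residual.X12SexticTwist.bsdp_three_cremona<N>_of_cor107`, which discharge `hr`). Not a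
restatement or slice of `thm1010_bsdThree_overK_sexticTwist`: that fact records
`r_an(E_d/K) = r_an(E_d/ℚ) + r_an(E_d^{(d_K)}/ℚ) = 1` and is silent on which summand vanishes; the
corollary is the additional published root-number content. Registry: HOME/CITED-FACTS.md
(harvest seat 1, gen 6).

## References
* [KrizLi2019] D. Kriz, C. Li, *Goldfeld's conjecture and congruences between Heegner points*,
  Forum Math. Sigma 7 (2019) e15, §10.2: Lemmas 10.4–10.5, Thm. 10.6, Cor. 10.7 (= arXiv:1609.06687v3
  `lem:rootnumberEd`, `lem:rootnumberEd2`, `thm:sextic`, `mod9corollary`).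
* E. Liverance, *A formula for the root number of a family of elliptic curves*, J. Number Theory 51
  (1995) 288–305, §9 (Kriz–Li's [46]; the local root numbers of `y² = x³ + k`).
* A. W. Knapp, *Elliptic Curves*, Princeton 1993, Thm. 11.67 (isogenous curves over `ℚ` have the
  same `L`-function; tree `analyticRank_eq_of_isIsogenous'`) — used by the consumer, not here.
-/

noncomputable section

open scoped Classical

open WeierstrassCurve NumberField Literature.NumberTheory.EllipticCurves
  Literature.NumberTheory.EllipticCurves.ModularForms

namespace Literature.NumberTheory.EllipticCurves.KrizLi2019

/-- **Kriz–Li, Forum Math. Sigma 7 (2019) e15, Corollary 10.7 (in the situation of Theorem 10.6)**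
(= arXiv:1609.06687v3 `mod9corollary` / `thm:sextic`): "[Theorem 10.6:] Let `K = ℚ(√d_K)` be an
imaginary quadratic field satisfying the Heegner hypothesis with respect to `3d`. Let `P_d ∈ E_d(K)`
be the associated Heegner point. Assume that: (1) `d` is a fundamental discriminant. (2)
`d ≡ 2 (mod 3)` or `d ≡ 3 (mod 9)`. (3) If `d > 0`, then `h₃(−3d) = h₃(d_K d) = 1`. If `d < 0`, then
`h₃(d) = h₃(−3d_K d) = 1`. […] [Corollary 10.7:] Assume we are in the situation of Theorem 10.6.
(1) If `d > 0` and `d ≡ 2 (mod 9)`, or `d < 0` and `d ≡ 3, 5, 8 (mod 9)`, then `r_an(E_d/ℚ) = 0`,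
`r_an(E_d^{(d_K)}/ℚ) = 1`. (2) If `d < 0` and `d ≡ 2 (mod 9)`, or `d > 0` and `d ≡ 3, 5, 8 (mod 9)`,
then `r_an(E_d/ℚ) = 1`, `r_an(E_d^{(d_K)}/ℚ) = 0`" — for the sextic twist `E_d : y² = x³ − 432d`
(CM, `j = 0`; `3` additive and Eisenstein), proved from Theorem 10.6 (`r_an(E_d/K) = 1`) and the
root numbers `w(E_d)` of Lemmas 10.4–10.5 ([Liverance1995, §9]). Tree rendering (module docstring
items 1–6): `W` any `ℚ`-model of `E_d` (`∃ C, C • W = ⟨0,0,0,0,−432d⟩`), `K` imaginary quadratic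
with the Heegner hypothesis for `3|d|`, (1)–(3) literally as in
`thm1010_bsdThree_overK_sexticTwist` (NO Manin-constant hypothesis here), conclusions on
`W.analyticRank` and on the analytic rank of the twist model `W.quadraticTwist d_K`. PUBLISHED.
[cite: KrizLi2019, Cor. 10.7 (with Thm. 10.6; §10.2, Lemmas 10.4–10.5)] -/
def cor107_analyticRank_sexticTwist : Prop :=
  ∀ (d : ℤ) (W : WeierstrassCurve ℚ) [W.IsElliptic] (K : Type) [Field K] [NumberField K],
    -- `W ≅_ℚ E_d : y² = x³ − 432 d`
    (∃ C : VariableChange ℚ, C • W = ({ a₁ := 0, a₂ := 0, a₃ := 0, a₄ := 0, a₆ := -432 * d } :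
      WeierstrassCurve ℚ)) →
    -- "the situation of Theorem 10.6": `K` imaginary quadratic with the Heegner hypothesis for `3d`
    IsImaginaryQuadratic K → SatisfiesHeegnerHypothesis (3 * d.natAbs) K →
    -- (1) `d` is a fundamental discriminant
    ((d % 4 = 1 ∧ Squarefree d ∧ d ≠ 1) ∨
      (4 ∣ d ∧ (d / 4 % 4 = 2 ∨ d / 4 % 4 = 3) ∧ Squarefree (d / 4))) →
    -- (2) `d ≡ 2 (mod 3)` or `d ≡ 3 (mod 9)`
    (d % 3 = 2 ∨ d % 9 = 3) →
    -- (3) the `3`-class-number conditions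
    (0 < d → ThreeClassNumberTrivial (-3 * d) ∧ ThreeClassNumberTrivial (NumberField.discr K * d)) →
    (d < 0 → ThreeClassNumberTrivial d ∧ ThreeClassNumberTrivial (-3 * NumberField.discr K * d)) →
    -- Corollary 10.7 (1) and (2)
    ((0 < d ∧ d % 9 = 2 ∨ d < 0 ∧ (d % 9 = 3 ∨ d % 9 = 5 ∨ d % 9 = 8)) →
        W.analyticRank = 0 ∧
          (W.quadraticTwist (((NumberField.discr K : ℤ) : ℚ))).analyticRank = 1) ∧
    ((d < 0 ∧ d % 9 = 2 ∨ 0 < d ∧ (d % 9 = 3 ∨ d % 9 = 5 ∨ d % 9 = 8)) →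
        W.analyticRank = 1 ∧
          (W.quadraticTwist (((NumberField.discr K : ℤ) : ℚ))).analyticRank = 0)

/-- Case (2) of Corollary 10.7 alone, the shape the X12 records consume: under the fact and the
hypotheses of Theorem 10.6, `d < 0, d ≡ 2 (mod 9)` or `d > 0, d ≡ 3, 5, 8 (mod 9)` gives
`r_an(E_d/ℚ) = 1`. [cite: KrizLi2019, Cor. 10.7 (2)] -/
theorem analyticRank_eq_one_of_cor107 (h107 : cor107_analyticRank_sexticTwist) (d : ℤ)
    (W : WeierstrassCurve ℚ) [W.IsElliptic] (K : Type) [Field K] [NumberField K]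
    (hW : ∃ C : VariableChange ℚ, C • W = ({ a₁ := 0, a₂ := 0, a₃ := 0, a₄ := 0, a₆ := -432 * d } :
      WeierstrassCurve ℚ))
    (hK : IsImaginaryQuadratic K) (hH : SatisfiesHeegnerHypothesis (3 * d.natAbs) K)
    (h1 : (d % 4 = 1 ∧ Squarefree d ∧ d ≠ 1) ∨
      (4 ∣ d ∧ (d / 4 % 4 = 2 ∨ d / 4 % 4 = 3) ∧ Squarefree (d / 4)))
    (h2 : d % 3 = 2 ∨ d % 9 = 3)
    (h3pos : 0 < d → ThreeClassNumberTrivial (-3 * d) ∧ ThreeClassNumberTrivial (NumberField.discr K * d))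
    (h3neg : d < 0 → ThreeClassNumberTrivial d ∧ ThreeClassNumberTrivial (-3 * NumberField.discr K * d))
    (hcase : d < 0 ∧ d % 9 = 2 ∨ 0 < d ∧ (d % 9 = 3 ∨ d % 9 = 5 ∨ d % 9 = 8)) :
    W.analyticRank = 1 :=
  ((h107 d W K hW hK hH h1 h2 h3pos h3neg).2 hcase).1

/-- Case (1) of Corollary 10.7 alone: `d > 0, d ≡ 2 (mod 9)` or `d < 0, d ≡ 3, 5, 8 (mod 9)` gives
`r_an(E_d/ℚ) = 0` (and the twist by `d_K` carries the simple zero). [cite: KrizLi2019, Cor. 10.7 (1)] -/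
theorem analyticRank_eq_zero_of_cor107 (h107 : cor107_analyticRank_sexticTwist) (d : ℤ)
    (W : WeierstrassCurve ℚ) [W.IsElliptic] (K : Type) [Field K] [NumberField K]
    (hW : ∃ C : VariableChange ℚ, C • W = ({ a₁ := 0, a₂ := 0, a₃ := 0, a₄ := 0, a₆ := -432 * d } :
      WeierstrassCurve ℚ))
    (hK : IsImaginaryQuadratic K) (hH : SatisfiesHeegnerHypothesis (3 * d.natAbs) K)
    (h1 : (d % 4 = 1 ∧ Squarefree d ∧ d ≠ 1) ∨
      (4 ∣ d ∧ (d / 4 % 4 = 2 ∨ d / 4 % 4 = 3) ∧ Squarefree (d / 4)))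
    (h2 : d % 3 = 2 ∨ d % 9 = 3)
    (h3pos : 0 < d → ThreeClassNumberTrivial (-3 * d) ∧ ThreeClassNumberTrivial (NumberField.discr K * d))
    (h3neg : d < 0 → ThreeClassNumberTrivial d ∧ ThreeClassNumberTrivial (-3 * NumberField.discr K * d))
    (hcase : 0 < d ∧ d % 9 = 2 ∨ d < 0 ∧ (d % 9 = 3 ∨ d % 9 = 5 ∨ d % 9 = 8)) :
    W.analyticRank = 0 ∧
      (W.quadraticTwist (((NumberField.discr K : ℤ) : ℚ))).analyticRank = 1 :=
  (h107 d W K hW hK hH h1 h2 h3pos h3neg).1 hcase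

end Literature.NumberTheory.EllipticCurves.KrizLi2019

end
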